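/-
Copyright: public-domain mathematics; typed transcription for the H21 Literature library (cell lit-balaban,
Phase-2 proof seat p38 gen 7 = literature-prover-lit-balaban-p38-g7-0).

statement-level skeleton of published theorems with citation tags; proofs where landed; nothing here is a claim about the Yang–Mills mass gap

# Bałaban, *Propagators and renormalization transformations for lattice gauge theories. I*,
# Commun. Math. Phys. **95** (1984) 17–40 — THE RIGHT AND LEFT CERTIFICATES (1.125)/(1.129)/(1.130) OF THE RANDOM WALK,
# IN `L²`, FOR THE OPERATOR `G = Δ_a⁻¹` OF RECORD (from (1.89) and the lattice Leibniz rules)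

[cite: Balaban1984PropagatorsI]  T. Bałaban, Commun. Math. Phys. 95 (1984) 17–40.  p. 38 (1.125) «For the first factor we have
‖ζ∇h_zGh_zA‖_α ≤ O(1)(‖ζ‖_α + |ζ|)|h_zA|»; (1.129) «|∇Gh_z∇*J| + |Gh_z∇*J| ≤ O(1)(‖J‖_ε + |J|)»; (1.130) «There is one possibility left
yet, namely that of the terms with one factor. Then we apply the inequality (1.117) together with (1.115), (1.116) and we get (1.130)»
[display (1.130), reconstructed from the formula layer: ‖ζ∇h_zGh_z∇*J‖_α ≤ O(1)(‖ζ‖_α + |ζ|)(‖J‖_{α+ε} + |J|)]; p. 39 «Let us notice that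
the proof of inequalities (1.114), describing the decay in L²-norms, is completed because we have proved inequalities (1.89)» and «The
proofs of the other inequalities are exactly the same, but in the estimates of G∇*J we have to take a representation of G adjoint to
(1.123), with the operators K(h) acting on the right».

WHAT THIS MODULE ADDS (SKELETON rows B5.Eq1.125 / B5.Eq1.129 / B5.Eq1.130 (L² readings), owner r02; GAPS G-B5-03, G-B5-24; target: the
field `hcert` of `B5Local114.Realisation` — per entry `m` of (1.114) a `B5Local114.RightCert` (m = 0, 1, 3, 4) or `LeftCert` (m = 2, 5) —
for r02's operator of record on the carrier of `B5WalkCarrierTorus`/`B5WalkEntriesTorus`).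
* §1 assembly lemmas on the graded carrier for DIVERGENCE-FED vectors (grade 0 fed by the grade-1 family, grade 1 by grade-2 families);
* §2 OPERATOR BOUNDS from the abstract Prop-1.1 clause with constant `γ₀` (all `B` of the carrier, all centres `z`):
  `‖Gh_zGB‖`-type `γ₀⁻¹`, `‖∇GB‖ ≤ γ₀⁻¹‖B‖`, `‖∇h_zGB‖ ≤ KF1‖B‖`, `‖∇∇GB‖ ≤ γ₀⁻¹‖B‖`, `‖∇∇h_zGB‖ ≤ KF2‖B‖`,
  `‖Gh_z∇*B‖, ‖Dg Gh_z∇*B‖ ≤ KD‖B‖` (h∇* = ∇*h + [h,∇*], (1.89) members ‖G∇*J‖, ‖∇G∇*J‖ + the commutator of `B5WalkLeibnizTorus`),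
  `‖∇h_zGh_z∇*B‖ ≤ KD1‖B‖` — with `KF1 = γ₀⁻¹(1 + √dLw/M₀)`, `KF2 = d²γ₀⁻¹(1 + 2Lw/M₀ + Kmix/M₀²)`, `KD = γ₀⁻¹(1 + dLw/M₀)`,
  `KD1 = KD(1 + √dLw/M₀)`, UNIFORM IN `η`;
* §3 the constants `cF, cL, c1` (functions of `γ₀`, given `d`) dominating all of these for `M₀ ≥ 1`;
* §4 THE SIX CERTIFICATES: `rightCert_zero/one/three/four`, `leftCert_two/five` in the exact shape of `B5Local114.RightCert/LeftCert`
  for `(St, G, Dg, H, ctr, site, vec, cut, D1v m, D2v m, Dadjv m)` of record with radius `c̄M₀` (any `c̄ ≥ 11/3`), and the field-shaped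
  `hcert_holds`.

HONEST SCOPE.  L² readings (p. 39); analytic input = the abstract Prop-1.1 clause (r02's `prop11Printed_latticeSettingP12R` discharges it
at the call site); constants unoptimised.  value = the located leaf `hcert` of `B5Local114.Realisation` for the torus of record — NOT
summit progress.
-/
import Mathlib
import Literature.MathematicalPhysics.QuantumFieldTheory.Balaban1983to89.B5Local114
import Literature.MathematicalPhysics.QuantumFieldTheory.Balaban1983to89.B5WalkLeibnizTorus

open scoped BigOperators Real Matrix
open Finset Matrix

namespace Literature.MathematicalPhysics.QuantumFieldTheory.Balaban1983to89.B5WalkCertsTorus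

open Literature.MathematicalPhysics.QuantumFieldTheory.Balaban1983to89
open Literature.MathematicalPhysics.QuantumFieldTheory.Balaban1983to89.B5Prop11Plancherel (Tor fine)
open Literature.MathematicalPhysics.QuantumFieldTheory.Balaban1983to89.B5Prop12FieldsLattice (cutSupL cutSupL_nonneg)
open Literature.MathematicalPhysics.QuantumFieldTheory.Balaban1983to89.B5CoverP12Lattice (Lw Lw_nonneg)
open Literature.MathematicalPhysics.QuantumFieldTheory.Balaban1983to89.B5Commutator128 (kerOp)
open Literature.MathematicalPhysics.QuantumFieldTheory.Balaban1983to89.B5TorusPartition (mulOp)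
open Literature.MathematicalPhysics.QuantumFieldTheory.Balaban1983to89.B5Local114 (RightCert LeftCert)
open Literature.MathematicalPhysics.QuantumFieldTheory.Balaban1983to89.B5RealFields (GR fdiffR l2R l2TR gradR grad2R divTR l2R_nonneg
  l2R_le_l2TR)
open Literature.MathematicalPhysics.QuantumFieldTheory.Balaban1983to89.B5SettingP12Real (LocR latticeSettingP12R)
open Literature.MathematicalPhysics.QuantumFieldTheory.Balaban1983to89.B5WalkTorusGeom (TorR ucPt sitePt Cen ctr)
open Literature.MathematicalPhysics.QuantumFieldTheory.Balaban1983to89.B5WalkPartitionTorus (hz)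
open Literature.MathematicalPhysics.QuantumFieldTheory.Balaban1983to89.B5WalkCarrierTorus (Gr Bnd Idx Vsp sl sl_apply normSq_eq_sum_l2R_sq
  Gop sl_Gop Hop norm_Hop_le Dg normSq_Dg h89_holds l2TR_gradR_GR_le_of_clause l2R_GR_le_of_clause norm_kerOp_liftK_le)
open Literature.MathematicalPhysics.QuantumFieldTheory.Balaban1983to89.B5WalkEntriesTorus (g0 g1 g2 sum_Gr normSq_Gr l2TR_sq_sum
  l2TR_nonneg l2R_zero gradOp divOp sl_gradOp_g0 sl_gradOp_g1 sl_gradOp_g2 sl_divOp_g0 sl_divOp_g1 sl_divOp_g2 normSq_gradOp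
  normSq_gradOp_gradOp norm_gradOp_le_of_sl norm_gradOp_gradOp_le_of_sl norm_le_of_sl cut norm_cut_le vsrc norm_vsrc D1v D2v Dadjv
  Dadjv_adjoint)
open Literature.MathematicalPhysics.QuantumFieldTheory.Balaban1983to89.B5WalkLocalityTorus (cut_D1v_Hop_eq_zero Hop_cut_eq_zero)
open Literature.MathematicalPhysics.QuantumFieldTheory.Balaban1983to89.B5WalkH128Torus (gz l2R_add_le)
open Literature.MathematicalPhysics.QuantumFieldTheory.Balaban1983to89.B5WalkLeibnizTorus (Kmix Kmix_nonneg l2R_GR_divTR_le_of_clause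
  l2TR_gradR_GR_divTR_le_of_clause l2TR_grad2R_GR_le_of_clause l2TR_add_le l2TR_smul_le l2R_smul_le l2TR_gradR_gz_mul_le l2R_gz_mul_le
  l2TR_grad2R_gz_mul_le mul_divTR_eq l2R_Ediv_le)

noncomputable section

variable {d : ℕ}

/-! ## §1 Divergence-fed vectors on the graded carrier -/

section DivFed

variable {n : ℕ} [NeZero n] {M : Fin d → ℕ} [hM : ∀ μ, NeZero (M μ)]

/-- `∇0 = 0`. [cite: Balaban1984PropagatorsI, (1.31) p.23] -/
theorem gradR_zero : gradR n M (0 : Bnd n M → ℝ) = 0 := by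
  funext ν b
  simp [gradR, Matrix.mulVec_zero]

/-- `‖0‖ = 0` for tensor fields. [cite: Balaban1984PropagatorsI, Prop. 1.1 p.33] -/
theorem l2TR_zero {S : Type*} [Fintype S] : l2TR (0 : S → Bnd n M → ℝ) = 0 := by simp [l2TR]

/-- **`‖f‖ ≤ K‖B‖` for a divergence-fed `f`**: grade 0 of `f` controlled by the grade-1 family of `B`, grade 1 of `f` by the grade-2
families of `B`, no grade 2. [cite: Balaban1984PropagatorsI, Prop. 1.1 (1.89) p.33 (‖G∇*J‖, ‖G∇*∇*J‖)] -/
theorem norm_le_of_div_fed {f B : Vsp n M} {K : ℝ} (hK : 0 ≤ K)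
    (h0 : l2R (sl f g0) ≤ K * l2TR (fun ν => sl B (g1 ν)))
    (h1 : ∀ μ, l2R (sl f (g1 μ)) ≤ K * l2TR (fun ν' => sl B (g2 (μ, ν'))))
    (h2 : ∀ p, sl f (g2 p) = 0) : ‖f‖ ≤ K * ‖B‖ := by
  have hsq : ‖f‖ ^ 2 ≤ (K * ‖B‖) ^ 2 := by
    rw [normSq_Gr, mul_pow, normSq_Gr B]
    have e2 : ∑ p, l2R (sl f (g2 p)) ^ 2 = 0 :=
      Finset.sum_eq_zero fun p _ => by rw [h2 p, l2R_zero, zero_pow two_ne_zero]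
    rw [e2, add_zero]
    have t0 := pow_le_pow_left₀ (l2R_nonneg _) h0 2
    rw [mul_pow, l2TR_sq_sum (fun ν => sl B (g1 ν))] at t0
    have t1 : ∑ μ, l2R (sl f (g1 μ)) ^ 2 ≤ K ^ 2 * ∑ p, l2R (sl B (g2 p)) ^ 2 := by
      rw [Fintype.sum_prod_type, Finset.mul_sum]
      refine Finset.sum_le_sum fun μ _ => ?_
      have t := pow_le_pow_left₀ (l2R_nonneg _) (h1 μ) 2
      rw [mul_pow, l2TR_sq_sum (fun ν' => sl B (g2 (μ, ν')))] at t
      exact t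
    have t2 : 0 ≤ K ^ 2 * l2R (sl B g0) ^ 2 := by positivity
    linarith
  exact (pow_le_pow_iff_left₀ (norm_nonneg _) (by positivity) two_ne_zero).mp hsq

/-- **`‖Dg f‖ ≤ K‖B‖` for a divergence-fed `f`** (gradient norms of the slices). [cite: Balaban1984PropagatorsI, Prop. 1.1 (1.89) p.33 (‖∇G∇*J‖)] -/
theorem norm_Dg_le_of_div_fed {f B : Vsp n M} {K : ℝ} (hK : 0 ≤ K)
    (h0 : l2TR (gradR n M (sl f g0)) ≤ K * l2TR (fun ν => sl B (g1 ν)))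
    (h1 : ∀ μ, l2TR (gradR n M (sl f (g1 μ))) ≤ K * l2TR (fun ν' => sl B (g2 (μ, ν'))))
    (h2 : ∀ p, sl f (g2 p) = 0) : ‖Dg n M f‖ ≤ K * ‖B‖ := by
  have hsq : ‖Dg n M f‖ ^ 2 ≤ (K * ‖B‖) ^ 2 := by
    rw [normSq_Dg, sum_Gr, mul_pow, normSq_Gr B]
    have e2 : ∑ p, l2TR (gradR n M (sl f (g2 p))) ^ 2 = 0 :=
      Finset.sum_eq_zero fun p _ => by rw [h2 p, gradR_zero, l2TR_zero, zero_pow two_ne_zero]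
    rw [e2, add_zero]
    have t0 := pow_le_pow_left₀ (l2TR_nonneg _) h0 2
    rw [mul_pow, l2TR_sq_sum (fun ν => sl B (g1 ν))] at t0
    have t1 : ∑ μ, l2TR (gradR n M (sl f (g1 μ))) ^ 2 ≤ K ^ 2 * ∑ p, l2R (sl B (g2 p)) ^ 2 := by
      rw [Fintype.sum_prod_type, Finset.mul_sum]
      refine Finset.sum_le_sum fun μ _ => ?_
      have t := pow_le_pow_left₀ (l2TR_nonneg _) (h1 μ) 2
      rw [mul_pow, l2TR_sq_sum (fun ν' => sl B (g2 (μ, ν')))] at t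
      exact t
    have t2 : 0 ≤ K ^ 2 * l2R (sl B g0) ^ 2 := by positivity
    linarith
  exact (pow_le_pow_iff_left₀ (norm_nonneg _) (by positivity) two_ne_zero).mp hsq

/-- **`‖∇f‖ ≤ K‖B‖` for a divergence-fed `f`**. [cite: Balaban1984PropagatorsI, (1.130) p.38 (ζ∇h_zGh_z∇*J)] -/
theorem norm_gradOp_le_of_div_fed {f B : Vsp n M} {K : ℝ} (hK : 0 ≤ K)
    (h0 : l2TR (gradR n M (sl f g0)) ≤ K * l2TR (fun ν => sl B (g1 ν)))
    (h1 : ∀ μ, l2TR (gradR n M (sl f (g1 μ))) ≤ K * l2TR (fun ν' => sl B (g2 (μ, ν')))) :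
    ‖gradOp n M f‖ ≤ K * ‖B‖ := by
  have hsq : ‖gradOp n M f‖ ^ 2 ≤ (K * ‖B‖) ^ 2 := by
    rw [normSq_gradOp, mul_pow, normSq_Gr B]
    have t0 := pow_le_pow_left₀ (l2TR_nonneg _) h0 2
    rw [mul_pow, l2TR_sq_sum (fun ν => sl B (g1 ν))] at t0
    have t1 : ∑ μ, l2TR (gradR n M (sl f (g1 μ))) ^ 2 ≤ K ^ 2 * ∑ p, l2R (sl B (g2 p)) ^ 2 := by
      rw [Fintype.sum_prod_type, Finset.mul_sum]
      refine Finset.sum_le_sum fun μ _ => ?_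
      have t := pow_le_pow_left₀ (l2TR_nonneg _) (h1 μ) 2
      rw [mul_pow, l2TR_sq_sum (fun ν' => sl B (g2 (μ, ν')))] at t
      exact t
    have t2 : 0 ≤ K ^ 2 * l2R (sl B g0) ^ 2 := by positivity
    linarith
  exact (pow_le_pow_iff_left₀ (norm_nonneg _) (by positivity) two_ne_zero).mp hsq

end DivFed

/-! ## §2 Operator bounds from the Prop-1.1 clause -/

section OpBounds

variable {n : ℕ} [NeZero n] {M : Fin d → ℕ} [hM : ∀ μ, NeZero (M μ)] {a : ℝ} {k : ℕ} {M₀ : ℕ}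

/-- `KF1 = γ₀⁻¹(1 + √d·Lw/M₀)`. [cite: Balaban1984PropagatorsI, (1.125) p.38] -/
def KF1 (d : ℕ) (γ₀ : ℝ) (M₀ : ℕ) : ℝ := γ₀⁻¹ * (1 + Real.sqrt d * (Lw d / M₀))

/-- `KF2 = d²γ₀⁻¹(1 + 2Lw/M₀ + Kmix/M₀²)`. [cite: Balaban1984PropagatorsI, (1.125) p.38 (∇∇ entries)] -/
def KF2 (d : ℕ) (γ₀ : ℝ) (M₀ : ℕ) : ℝ := (d : ℝ) ^ 2 * (γ₀⁻¹ * (1 + 2 * (Lw d / M₀) + Kmix / (M₀ : ℝ) ^ 2))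

/-- `KD = γ₀⁻¹(1 + d·Lw/M₀)`. [cite: Balaban1984PropagatorsI, (1.129) p.38] -/
def KD (d : ℕ) (γ₀ : ℝ) (M₀ : ℕ) : ℝ := γ₀⁻¹ * (1 + d * (Lw d / M₀))

/-- `KD1 = KD·(1 + √d·Lw/M₀)`. [cite: Balaban1984PropagatorsI, (1.130) p.38] -/
def KD1 (d : ℕ) (γ₀ : ℝ) (M₀ : ℕ) : ℝ := KD d γ₀ M₀ * (1 + Real.sqrt d * (Lw d / M₀))

omit [NeZero n] hM in
/-- nonnegativity of the constants. [cite: Balaban1984PropagatorsI, p.38] -/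
theorem KF1_nonneg {γ₀ : ℝ} (hγ : 0 < γ₀) : 0 ≤ KF1 d γ₀ M₀ := by
  unfold KF1; have := Lw_nonneg d; positivity

omit [NeZero n] hM in
/-- nonnegativity of the constants. [cite: Balaban1984PropagatorsI, p.38] -/
theorem KF2_nonneg {γ₀ : ℝ} (hγ : 0 < γ₀) : 0 ≤ KF2 d γ₀ M₀ := by
  unfold KF2; have := Lw_nonneg d; have := Kmix_nonneg; positivity

omit [NeZero n] hM in
/-- nonnegativity of the constants. [cite: Balaban1984PropagatorsI, p.38] -/
theorem KD_nonneg {γ₀ : ℝ} (hγ : 0 < γ₀) : 0 ≤ KD d γ₀ M₀ := by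
  unfold KD; have := Lw_nonneg d; positivity

omit [NeZero n] hM in
/-- nonnegativity of the constants. [cite: Balaban1984PropagatorsI, p.38] -/
theorem KD1_nonneg {γ₀ : ℝ} (hγ : 0 < γ₀) : 0 ≤ KD1 d γ₀ M₀ := by
  unfold KD1; have := Lw_nonneg d; have := KD_nonneg (d := d) (M₀ := M₀) hγ; positivity

omit [NeZero n] hM in
/-- slices of `h_z f`. [cite: Balaban1984PropagatorsI, (1.118) p.36] -/
theorem sl_Hop_gz (z : Cen M M₀) (f : Vsp n M) (r : Gr d) : sl (Hop n M M₀ z f) r = fun b => gz n M M₀ z b * sl f r b := rfl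

/-- `(∇*g)_μ` as a divergence of the grade-2 family. [cite: Balaban1984PropagatorsI, Prop. 1.1 (1.89) p.33] -/
theorem sl_divOp_g1' (g : Vsp n M) (μ : Fin d) : sl (divOp n M g) (g1 μ) = divTR n M fun ν' => sl g (g2 (μ, ν')) :=
  sl_divOp_g1 g μ

section WithClause

variable {γ₀ : ℝ} (hn : 1 ≤ n) (hM₀ : 1 ≤ M₀) (hγ : 0 < γ₀)
  (hcl : ∀ (m : Fin 6) (J : LocR n M), (latticeSettingP12R n M a k).l2op m J ≤ γ₀⁻¹ * (latticeSettingP12R n M a k).l2Norm J)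
include hn hγ hcl

/-- **`‖GB‖ ≤ γ₀⁻¹‖B‖`** on the carrier. [cite: Balaban1984PropagatorsI, Prop. 1.1 (1.89) p.33] -/
theorem norm_Gop_le (B : Vsp n M) : ‖Gop n M a B‖ ≤ γ₀⁻¹ * ‖B‖ := (h89_holds hn γ₀ hγ hcl).1 B

/-- **`‖Dg(GB)‖ ≤ γ₀⁻¹‖B‖`** on the carrier. [cite: Balaban1984PropagatorsI, Prop. 1.1 (1.89) p.33] -/
theorem norm_Dg_Gop_le (B : Vsp n M) : ‖Dg n M (Gop n M a B)‖ ≤ γ₀⁻¹ * ‖B‖ := (h89_holds hn γ₀ hγ hcl).2 B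

/-- **`‖∇GB‖ ≤ γ₀⁻¹‖B‖`**. [cite: Balaban1984PropagatorsI, Prop. 1.1 (1.89) p.33 (‖∇GJ‖)] -/
theorem norm_gradOp_Gop_le (B : Vsp n M) : ‖gradOp n M (Gop n M a B)‖ ≤ γ₀⁻¹ * ‖B‖ :=
  norm_gradOp_le_of_sl (inv_pos.mpr hγ).le (by rw [sl_Gop]; exact l2TR_gradR_GR_le_of_clause hn hcl _)
    (fun μ => by rw [sl_Gop]; exact l2TR_gradR_GR_le_of_clause hn hcl _)

/-- **`‖∇∇GB‖ ≤ γ₀⁻¹‖B‖`**. [cite: Balaban1984PropagatorsI, Prop. 1.1 (1.89) p.33 (‖∇∇GJ‖)] -/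
theorem norm_gradOp_gradOp_Gop_le (B : Vsp n M) : ‖gradOp n M (gradOp n M (Gop n M a B))‖ ≤ γ₀⁻¹ * ‖B‖ :=
  norm_gradOp_gradOp_le_of_sl (inv_pos.mpr hγ).le (by rw [sl_Gop]; exact l2TR_grad2R_GR_le_of_clause hn hcl _)

include hM₀

omit hγ in
/-- slicewise: `‖∇(h_z G v)‖ ≤ KF1‖v‖`. [cite: Balaban1984PropagatorsI, (1.125) p.38] -/
theorem l2TR_gradR_gz_GR_le (z : Cen M M₀) (v : Bnd n M → ℝ) :
    l2TR (gradR n M fun b => gz n M M₀ z b * (GR n M a *ᵥ v) b) ≤ KF1 d γ₀ M₀ * l2R v := by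
  have h1 := l2TR_gradR_gz_mul_le hn hM₀ z (GR n M a *ᵥ v)
  have h2 := l2TR_gradR_GR_le_of_clause hn hcl v
  have h3 := l2R_GR_le_of_clause hn hcl v
  have hL : 0 ≤ Real.sqrt d * (Lw d / M₀) := by have := Lw_nonneg d; positivity
  calc _ ≤ l2TR (gradR n M (GR n M a *ᵥ v)) + Real.sqrt d * (Lw d / M₀) * l2R (GR n M a *ᵥ v) := h1
    _ ≤ γ₀⁻¹ * l2R v + Real.sqrt d * (Lw d / M₀) * (γ₀⁻¹ * l2R v) := add_le_add h2 (mul_le_mul_of_nonneg_left h3 hL)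
    _ = KF1 d γ₀ M₀ * l2R v := by unfold KF1; ring

/-- **`‖∇h_zGB‖ ≤ KF1‖B‖`** — the first-factor estimate (1.125) in `L²`. [cite: Balaban1984PropagatorsI, (1.125) p.38] -/
theorem norm_gradOp_Hop_Gop_le (z : Cen M M₀) (B : Vsp n M) :
    ‖gradOp n M (Hop n M M₀ z (Gop n M a B))‖ ≤ KF1 d γ₀ M₀ * ‖B‖ :=
  norm_gradOp_le_of_sl (KF1_nonneg hγ) (by rw [sl_Hop_gz, sl_Gop]; exact l2TR_gradR_gz_GR_le hn hM₀ hcl z _)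
    (fun μ => by rw [sl_Hop_gz, sl_Gop]; exact l2TR_gradR_gz_GR_le hn hM₀ hcl z _)

omit hγ in
/-- slicewise: `‖∇∇(h_z G v)‖ ≤ KF2‖v‖`. [cite: Balaban1984PropagatorsI, (1.125) p.38 (∇∇ entries)] -/
theorem l2TR_grad2R_gz_GR_le (z : Cen M M₀) (v : Bnd n M → ℝ) :
    l2TR (grad2R n M fun b => gz n M M₀ z b * (GR n M a *ᵥ v) b) ≤ KF2 d γ₀ M₀ * l2R v := by
  have h1 := l2TR_grad2R_gz_mul_le hn hM₀ z (GR n M a *ᵥ v)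
  have h2 := l2TR_grad2R_GR_le_of_clause hn hcl v
  have h3 := l2TR_gradR_GR_le_of_clause hn hcl v
  have h4 := l2R_GR_le_of_clause hn hcl v
  have hL : 0 ≤ 2 * (Lw d / M₀) := by have := Lw_nonneg d; positivity
  have hK : 0 ≤ Kmix / (M₀ : ℝ) ^ 2 := div_nonneg Kmix_nonneg (sq_nonneg _)
  calc _ ≤ (d : ℝ) ^ 2 * (l2TR (grad2R n M (GR n M a *ᵥ v)) + 2 * (Lw d / M₀) * l2TR (gradR n M (GR n M a *ᵥ v))
        + Kmix / (M₀ : ℝ) ^ 2 * l2R (GR n M a *ᵥ v)) := h1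
    _ ≤ (d : ℝ) ^ 2 * (γ₀⁻¹ * l2R v + 2 * (Lw d / M₀) * (γ₀⁻¹ * l2R v) + Kmix / (M₀ : ℝ) ^ 2 * (γ₀⁻¹ * l2R v)) := by
        gcongr
    _ = KF2 d γ₀ M₀ * l2R v := by unfold KF2; ring

/-- **`‖∇∇h_zGB‖ ≤ KF2‖B‖`**. [cite: Balaban1984PropagatorsI, (1.125) p.38, Prop. 1.2 (1.114) p.36 (‖ζ∇∇GJ‖)] -/
theorem norm_gradOp_gradOp_Hop_Gop_le (z : Cen M M₀) (B : Vsp n M) :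
    ‖gradOp n M (gradOp n M (Hop n M M₀ z (Gop n M a B)))‖ ≤ KF2 d γ₀ M₀ * ‖B‖ :=
  norm_gradOp_gradOp_le_of_sl (KF2_nonneg hγ) (by rw [sl_Hop_gz, sl_Gop]; exact l2TR_grad2R_gz_GR_le hn hM₀ hcl z _)

/-- slicewise: `‖G(h_z∇*J)‖ ≤ KD‖J‖` via `h∇*J = ∇*(hJ) + E`. [cite: Balaban1984PropagatorsI, (1.129) p.38, p.39 (adjoint representation)] -/
theorem l2R_GR_gz_divTR_le (z : Cen M M₀) (J : Fin d → Bnd n M → ℝ) :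
    l2R (GR n M a *ᵥ fun b => gz n M M₀ z b * divTR n M J b) ≤ KD d γ₀ M₀ * l2TR J := by
  rw [mul_divTR_eq, Matrix.mulVec_add]
  have h1 := l2R_GR_divTR_le_of_clause hn hcl (fun ν b => gz n M M₀ z b * J ν b)
  have h2 := l2TR_smul_le (S := Fin d) (fun b => B5WalkH128Torus.abs_gz_le_one (n := n) z b) J
  have h3 := l2R_GR_le_of_clause hn hcl (B5WalkLeibnizTorus.Ediv (gz n M M₀ z) J)
  have h4 := l2R_Ediv_le hn hM₀ z J
  have hγ' : 0 ≤ γ₀⁻¹ := (inv_pos.mpr hγ).le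
  calc _ ≤ l2R (GR n M a *ᵥ divTR n M fun ν b => gz n M M₀ z b * J ν b) + l2R (GR n M a *ᵥ B5WalkLeibnizTorus.Ediv (gz n M M₀ z) J) :=
        l2R_add_le _ _
    _ ≤ γ₀⁻¹ * l2TR J + γ₀⁻¹ * (d * (Lw d / M₀) * l2TR J) :=
        add_le_add (h1.trans (mul_le_mul_of_nonneg_left h2 hγ')) (h3.trans (mul_le_mul_of_nonneg_left h4 hγ'))
    _ = KD d γ₀ M₀ * l2TR J := by unfold KD; ring

omit hn hγ hcl hM₀ in
/-- `∇` is additive. [cite: Balaban1984PropagatorsI, (1.31) p.23] -/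
theorem gradR_add (u w : Bnd n M → ℝ) : gradR n M (u + w) = gradR n M u + gradR n M w := by
  funext ν b
  simp [gradR, Matrix.mulVec_add]

/-- slicewise: `‖∇G(h_z∇*J)‖ ≤ KD‖J‖`. [cite: Balaban1984PropagatorsI, (1.129) p.38] -/
theorem l2TR_gradR_GR_gz_divTR_le (z : Cen M M₀) (J : Fin d → Bnd n M → ℝ) :
    l2TR (gradR n M (GR n M a *ᵥ fun b => gz n M M₀ z b * divTR n M J b)) ≤ KD d γ₀ M₀ * l2TR J := by
  rw [mul_divTR_eq, Matrix.mulVec_add, gradR_add]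
  have h1 := l2TR_gradR_GR_divTR_le_of_clause hn hcl (fun ν b => gz n M M₀ z b * J ν b)
  have h2 := l2TR_smul_le (S := Fin d) (fun b => B5WalkH128Torus.abs_gz_le_one (n := n) z b) J
  have h3 := l2TR_gradR_GR_le_of_clause hn hcl (B5WalkLeibnizTorus.Ediv (gz n M M₀ z) J)
  have h4 := l2R_Ediv_le hn hM₀ z J
  have hγ' : 0 ≤ γ₀⁻¹ := (inv_pos.mpr hγ).le
  calc _ ≤ l2TR (gradR n M (GR n M a *ᵥ divTR n M fun ν b => gz n M M₀ z b * J ν b))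
        + l2TR (gradR n M (GR n M a *ᵥ B5WalkLeibnizTorus.Ediv (gz n M M₀ z) J)) := l2TR_add_le _ _
    _ ≤ γ₀⁻¹ * l2TR J + γ₀⁻¹ * (d * (Lw d / M₀) * l2TR J) :=
        add_le_add (h1.trans (mul_le_mul_of_nonneg_left h2 hγ')) (h3.trans (mul_le_mul_of_nonneg_left h4 hγ'))
    _ = KD d γ₀ M₀ * l2TR J := by unfold KD; ring

/-- slicewise: `‖∇(h_zG(h_z∇*J))‖ ≤ KD1‖J‖`. [cite: Balaban1984PropagatorsI, (1.130) p.38] -/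
theorem l2TR_gradR_gz_GR_gz_divTR_le (z : Cen M M₀) (J : Fin d → Bnd n M → ℝ) :
    l2TR (gradR n M fun b => gz n M M₀ z b * (GR n M a *ᵥ fun b' => gz n M M₀ z b' * divTR n M J b') b)
      ≤ KD1 d γ₀ M₀ * l2TR J := by
  have h1 := l2TR_gradR_gz_mul_le hn hM₀ z (GR n M a *ᵥ fun b' => gz n M M₀ z b' * divTR n M J b')
  have h2 := l2TR_gradR_GR_gz_divTR_le hn hM₀ hγ hcl z J
  have h3 := l2R_GR_gz_divTR_le hn hM₀ hγ hcl z J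
  have hL : 0 ≤ Real.sqrt d * (Lw d / M₀) := by have := Lw_nonneg d; positivity
  calc _ ≤ _ := h1
    _ ≤ KD d γ₀ M₀ * l2TR J + Real.sqrt d * (Lw d / M₀) * (KD d γ₀ M₀ * l2TR J) :=
        add_le_add h2 (mul_le_mul_of_nonneg_left h3 hL)
    _ = KD1 d γ₀ M₀ * l2TR J := by unfold KD1; ring

omit hn hγ hcl hM₀ in
/-- the grade-2 slices of `Gh_z∇*B` vanish. [cite: Balaban1984PropagatorsI, Prop. 1.1 p.33] -/
theorem sl_Gop_Hop_divOp_g2 (z : Cen M M₀) (B : Vsp n M) (p : Fin d × Fin d) :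
    sl (Gop n M a (Hop n M M₀ z (divOp n M B))) (g2 p) = 0 := by
  rw [sl_Gop, sl_Hop_gz, sl_divOp_g2]
  have : (fun b => gz n M M₀ z b * (0 : Bnd n M → ℝ) b) = 0 := by funext b; simp
  rw [this, Matrix.mulVec_zero]

/-- **`‖Gh_z∇*B‖ ≤ KD‖B‖`** on the carrier — (1.129) in `L²`. [cite: Balaban1984PropagatorsI, (1.129) p.38] -/
theorem norm_Gop_Hop_divOp_le (z : Cen M M₀) (B : Vsp n M) :
    ‖Gop n M a (Hop n M M₀ z (divOp n M B))‖ ≤ KD d γ₀ M₀ * ‖B‖ :=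
  norm_le_of_div_fed (KD_nonneg hγ)
    (by rw [sl_Gop, sl_Hop_gz, sl_divOp_g0]; exact l2R_GR_gz_divTR_le hn hM₀ hγ hcl z _)
    (fun μ => by rw [sl_Gop, sl_Hop_gz, sl_divOp_g1']; exact l2R_GR_gz_divTR_le hn hM₀ hγ hcl z _)
    (sl_Gop_Hop_divOp_g2 z B)

/-- **`‖Dg Gh_z∇*B‖ ≤ KD‖B‖`** on the carrier — (1.129) in `L²`. [cite: Balaban1984PropagatorsI, (1.129) p.38] -/
theorem norm_Dg_Gop_Hop_divOp_le (z : Cen M M₀) (B : Vsp n M) :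
    ‖Dg n M (Gop n M a (Hop n M M₀ z (divOp n M B)))‖ ≤ KD d γ₀ M₀ * ‖B‖ :=
  norm_Dg_le_of_div_fed (KD_nonneg hγ)
    (by rw [sl_Gop, sl_Hop_gz, sl_divOp_g0]; exact l2TR_gradR_GR_gz_divTR_le hn hM₀ hγ hcl z _)
    (fun μ => by rw [sl_Gop, sl_Hop_gz, sl_divOp_g1']; exact l2TR_gradR_GR_gz_divTR_le hn hM₀ hγ hcl z _)
    (sl_Gop_Hop_divOp_g2 z B)

/-- **`‖∇h_zGh_z∇*B‖ ≤ KD1‖B‖`** on the carrier — the one-factor term (1.130) in `L²`. [cite: Balaban1984PropagatorsI, (1.130) p.38] -/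
theorem norm_gradOp_Hop_Gop_Hop_divOp_le (z : Cen M M₀) (B : Vsp n M) :
    ‖gradOp n M (Hop n M M₀ z (Gop n M a (Hop n M M₀ z (divOp n M B))))‖ ≤ KD1 d γ₀ M₀ * ‖B‖ :=
  norm_gradOp_le_of_div_fed (KD1_nonneg hγ)
    (by rw [sl_Hop_gz, sl_Gop, sl_Hop_gz, sl_divOp_g0]; exact l2TR_gradR_gz_GR_gz_divTR_le hn hM₀ hγ hcl z _)
    (fun μ => by rw [sl_Hop_gz, sl_Gop, sl_Hop_gz, sl_divOp_g1']; exact l2TR_gradR_gz_GR_gz_divTR_le hn hM₀ hγ hcl z _)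

end WithClause

end OpBounds

/-! ## §3 The constants `cF, cL, c1` -/

section Consts

/-- **`c_F(γ₀) = γ₀⁻¹·((1 + √dLw) + d²(1 + 2Lw + Kmix))`** — the `O(1)` of (1.125) in `L²` (dominates `γ₀⁻¹, KF1, KF2` for `M₀ ≥ 1`).
[cite: Balaban1984PropagatorsI, (1.125) p.38] -/
def cF (d : ℕ) (γ₀ : ℝ) : ℝ := γ₀⁻¹ * ((1 + Real.sqrt d * Lw d) + (d : ℝ) ^ 2 * (1 + 2 * Lw d + Kmix))

/-- **`c_L(γ₀) = 2γ₀⁻¹(1 + dLw)`** — the `O(1)` of (1.129) in `L²`. [cite: Balaban1984PropagatorsI, (1.129) p.38] -/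
def cL (d : ℕ) (γ₀ : ℝ) : ℝ := 2 * (γ₀⁻¹ * (1 + d * Lw d))

/-- **`c₁(γ₀) = γ₀⁻¹(1 + dLw)(1 + √dLw) + c_F(γ₀)`** — the `O(1)` of (1.130) in `L²`. [cite: Balaban1984PropagatorsI, (1.130) p.38] -/
def c1 (d : ℕ) (γ₀ : ℝ) : ℝ := γ₀⁻¹ * (1 + d * Lw d) * (1 + Real.sqrt d * Lw d) + cF d γ₀

variable {M₀ : ℕ} {γ₀ : ℝ}

/-- `Lw/M₀ ≤ Lw` for `M₀ ≥ 1`. (plumbing) [cite: Balaban1984PropagatorsI, p.39 (M₀ depending on d only)] -/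
theorem Lw_div_le (hM₀ : 1 ≤ M₀) : Lw d / M₀ ≤ Lw d :=
  div_le_self (Lw_nonneg d) (by exact_mod_cast hM₀)

/-- `0 ≤ c_F`. [cite: Balaban1984PropagatorsI, (1.125) p.38] -/
theorem cF_nonneg (hγ : 0 ≤ γ₀) : 0 ≤ cF d γ₀ := by
  unfold cF; have := Lw_nonneg d; have := Kmix_nonneg; positivity

/-- `0 ≤ c_L`. [cite: Balaban1984PropagatorsI, (1.129) p.38] -/
theorem cL_nonneg (hγ : 0 ≤ γ₀) : 0 ≤ cL d γ₀ := by
  unfold cL; have := Lw_nonneg d; positivity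

/-- `0 ≤ c₁`. [cite: Balaban1984PropagatorsI, (1.130) p.38] -/
theorem c1_nonneg (hγ : 0 ≤ γ₀) : 0 ≤ c1 d γ₀ := by
  unfold c1; have := Lw_nonneg d; have := cF_nonneg (d := d) hγ; positivity

/-- `γ₀⁻¹ ≤ c_F`. [cite: Balaban1984PropagatorsI, (1.125) p.38] -/
theorem inv_le_cF (hγ : 0 < γ₀) : γ₀⁻¹ ≤ cF d γ₀ := by
  unfold cF
  have hL := Lw_nonneg d; have hK := Kmix_nonneg
  have : (1 : ℝ) ≤ (1 + Real.sqrt d * Lw d) + (d : ℝ) ^ 2 * (1 + 2 * Lw d + Kmix) := by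
    have : (0 : ℝ) ≤ Real.sqrt d * Lw d := by positivity
    have : (0 : ℝ) ≤ (d : ℝ) ^ 2 * (1 + 2 * Lw d + Kmix) := by positivity
    linarith
  exact le_mul_of_one_le_right (inv_pos.mpr hγ).le this

/-- `KF1 ≤ c_F`. [cite: Balaban1984PropagatorsI, (1.125) p.38] -/
theorem KF1_le_cF (hM₀ : 1 ≤ M₀) (hγ : 0 < γ₀) : KF1 d γ₀ M₀ ≤ cF d γ₀ := by
  unfold KF1 cF
  refine mul_le_mul_of_nonneg_left ?_ (inv_pos.mpr hγ).le
  have h1 := mul_le_mul_of_nonneg_left (Lw_div_le (d := d) hM₀) (Real.sqrt_nonneg d)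
  have : (0 : ℝ) ≤ (d : ℝ) ^ 2 * (1 + 2 * Lw d + Kmix) := by have := Lw_nonneg d; have := Kmix_nonneg; positivity
  linarith

/-- `KF2 ≤ c_F`. [cite: Balaban1984PropagatorsI, (1.125) p.38] -/
theorem KF2_le_cF (hM₀ : 1 ≤ M₀) (hγ : 0 < γ₀) : KF2 d γ₀ M₀ ≤ cF d γ₀ := by
  unfold KF2 cF
  have hL := Lw_nonneg d; have hK := Kmix_nonneg
  have hM1 : (1 : ℝ) ≤ M₀ := by exact_mod_cast hM₀
  have h1 := Lw_div_le (d := d) hM₀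
  have h2 : Kmix / (M₀ : ℝ) ^ 2 ≤ Kmix := div_le_self hK (by nlinarith)
  have hγ' := (inv_pos.mpr hγ).le
  have : (d : ℝ) ^ 2 * (γ₀⁻¹ * (1 + 2 * (Lw d / M₀) + Kmix / (M₀ : ℝ) ^ 2)) ≤ (d : ℝ) ^ 2 * (γ₀⁻¹ * (1 + 2 * Lw d + Kmix)) := by
    gcongr
  refine this.trans ?_
  have : (0 : ℝ) ≤ γ₀⁻¹ * (1 + Real.sqrt d * Lw d) := by positivity
  nlinarith

/-- `2γ₀⁻¹ ≤ c_L`. [cite: Balaban1984PropagatorsI, (1.129) p.38] -/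
theorem two_inv_le_cL (hγ : 0 < γ₀) : 2 * γ₀⁻¹ ≤ cL d γ₀ := by
  unfold cL
  have : (0 : ℝ) ≤ d * Lw d := by have := Lw_nonneg d; positivity
  have hγ' := (inv_pos.mpr hγ).le
  nlinarith

/-- `2KD ≤ c_L`. [cite: Balaban1984PropagatorsI, (1.129) p.38] -/
theorem two_KD_le_cL (hM₀ : 1 ≤ M₀) (hγ : 0 < γ₀) : 2 * KD d γ₀ M₀ ≤ cL d γ₀ := by
  unfold KD cL
  have h1 := mul_le_mul_of_nonneg_left (Lw_div_le (d := d) hM₀) (Nat.cast_nonneg d)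
  have hγ' := (inv_pos.mpr hγ).le
  nlinarith

/-- `c_F ≤ c₁`. [cite: Balaban1984PropagatorsI, (1.130) p.38] -/
theorem cF_le_c1 (hγ : 0 < γ₀) : cF d γ₀ ≤ c1 d γ₀ := by
  unfold c1
  have : (0 : ℝ) ≤ γ₀⁻¹ * (1 + d * Lw d) * (1 + Real.sqrt d * Lw d) := by have := Lw_nonneg d; positivity
  linarith

/-- `KD1 ≤ c₁`. [cite: Balaban1984PropagatorsI, (1.130) p.38] -/
theorem KD1_le_c1 (hM₀ : 1 ≤ M₀) (hγ : 0 < γ₀) : KD1 d γ₀ M₀ ≤ c1 d γ₀ := by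
  unfold KD1 KD c1
  have hL := Lw_nonneg d
  have h1 := Lw_div_le (d := d) hM₀
  have hγ' := (inv_pos.mpr hγ).le
  have hc := cF_nonneg (d := d) hγ.le
  have : γ₀⁻¹ * (1 + d * (Lw d / M₀)) * (1 + Real.sqrt d * (Lw d / M₀)) ≤ γ₀⁻¹ * (1 + d * Lw d) * (1 + Real.sqrt d * Lw d) := by
    gcongr
  linarith

end Consts

/-! ## §4 The six certificates -/

section Certs

variable {n : ℕ} [NeZero n] {M : Fin d → ℕ} [hM : ∀ μ, NeZero (M μ)] {a : ℝ} {k : ℕ} {M₀ : ℕ}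

/-- the table `D₁` at the six entries. [cite: Balaban1984PropagatorsI, Prop. 1.2 (1.114) p.36] -/
theorem D1v_zero : D1v n M 0 = 1 := rfl
/-- the table `D₁` at the six entries. [cite: Balaban1984PropagatorsI, Prop. 1.2 (1.114) p.36] -/
theorem D1v_one : D1v n M 1 = gradOp n M := rfl
/-- the table `D₁` at the six entries. [cite: Balaban1984PropagatorsI, Prop. 1.2 (1.114) p.36] -/
theorem D1v_three : D1v n M 3 = gradOp n M := rfl
/-- the table `D₁` at the six entries. [cite: Balaban1984PropagatorsI, Prop. 1.2 (1.114) p.36] -/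
theorem D1v_four : D1v n M 4 = gradOp n M * gradOp n M := rfl
/-- the table `D₂` at the six entries. [cite: Balaban1984PropagatorsI, Prop. 1.2 (1.114) p.36] -/
theorem D2v_zero : D2v n M 0 = 1 := rfl
/-- the table `D₂` at the six entries. [cite: Balaban1984PropagatorsI, Prop. 1.2 (1.114) p.36] -/
theorem D2v_one : D2v n M 1 = 1 := rfl
/-- the table `D₂` at the six entries. [cite: Balaban1984PropagatorsI, Prop. 1.2 (1.114) p.36] -/
theorem D2v_two : D2v n M 2 = divOp n M := rfl
/-- the table `D₂` at the six entries. [cite: Balaban1984PropagatorsI, Prop. 1.2 (1.114) p.36] -/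
theorem D2v_three : D2v n M 3 = divOp n M := rfl
/-- the table `D₂` at the six entries. [cite: Balaban1984PropagatorsI, Prop. 1.2 (1.114) p.36] -/
theorem D2v_four : D2v n M 4 = 1 := rfl
/-- the table `D₂` at the six entries. [cite: Balaban1984PropagatorsI, Prop. 1.2 (1.114) p.36] -/
theorem D2v_five : D2v n M 5 = divOp n M * divOp n M := rfl
/-- the table `D₂†` at the six entries. [cite: Balaban1984PropagatorsI, p.39] -/
theorem Dadjv_two : Dadjv n M 2 = gradOp n M := rfl
/-- the table `D₂†` at the six entries. [cite: Balaban1984PropagatorsI, p.39] -/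
theorem Dadjv_five : Dadjv n M 5 = gradOp n M * gradOp n M := rfl

variable {γ₀ : ℝ} (hn : 1 ≤ n) (hM₀ : 1 ≤ M₀) (hγ : 0 < γ₀)
  (hcl : ∀ (m : Fin 6) (J : LocR n M), (latticeSettingP12R n M a k).l2op m J ≤ γ₀⁻¹ * (latticeSettingP12R n M a k).l2Norm J)
  {cbar : ℝ} (hc : 11 / 3 ≤ cbar)
include hn hM₀ hγ hcl hc

omit hγ hcl hc hn hM₀ in
/-- `‖h_z (vec J)‖ ≤ ‖J‖`. [cite: Balaban1984PropagatorsI, (1.118) p.36, (1.21) p.21] -/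
theorem norm_Hop_vsrc_le (z : Cen M M₀) (J : LocR n M) : ‖Hop n M M₀ z (vsrc n M J)‖ ≤ (latticeSettingP12R n M a k).l2Norm J :=
  (norm_Hop_le z _).trans (norm_vsrc a k J).le

omit hM₀ hc in
/-- the last-factor member (4) for the entries with `D₂ = 1`. [cite: Balaban1984PropagatorsI, (1.129) p.38, (1.89) p.33] -/
theorem member4_one (J : LocR n M) (z : Cen M M₀) :
    ‖Dg n M (Gop n M a (Hop n M M₀ z (vsrc n M J)))‖ + ‖Gop n M a (Hop n M M₀ z (vsrc n M J))‖
      ≤ cL d γ₀ * (latticeSettingP12R n M a k).l2Norm J := by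
  have h1 := norm_Dg_Gop_le hn hγ hcl (Hop n M M₀ z (vsrc n M J))
  have h2 := norm_Gop_le hn hγ hcl (Hop n M M₀ z (vsrc n M J))
  have h3 := norm_Hop_vsrc_le (a := a) (k := k) z J
  have h4 := two_inv_le_cL (d := d) hγ
  have hγ' := (inv_pos.mpr hγ).le
  have hJ : 0 ≤ (latticeSettingP12R n M a k).l2Norm J := (norm_nonneg _).trans h3
  calc _ ≤ γ₀⁻¹ * ‖Hop n M M₀ z (vsrc n M J)‖ + γ₀⁻¹ * ‖Hop n M M₀ z (vsrc n M J)‖ := add_le_add h1 h2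
    _ ≤ (2 * γ₀⁻¹) * (latticeSettingP12R n M a k).l2Norm J := by nlinarith
    _ ≤ _ := mul_le_mul_of_nonneg_right h4 hJ

omit hn hM₀ hγ hcl hc in
/-- the one-factor member (5) from a first-factor operator bound, entries with `D₂ = 1`. [cite: Balaban1984PropagatorsI, (1.130) p.38] -/
theorem member5_one {D : Module.End ℝ (Vsp n M)} {K : ℝ} (hK : 0 ≤ K) (hKc : K ≤ c1 d γ₀)
    (hD : ∀ (z : Cen M M₀) (B : Vsp n M), ‖D (Hop n M M₀ z (Gop n M a B))‖ ≤ K * ‖B‖)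
    (ζ : Tor (fine n M) → ℝ) (J : LocR n M) (z : Cen M M₀) :
    ‖cut n M ζ (D (Hop n M M₀ z (Gop n M a (Hop n M M₀ z (vsrc n M J)))))‖
      ≤ c1 d γ₀ * cutSupL n M ζ * (latticeSettingP12R n M a k).l2Norm J := by
  have h1 := norm_cut_le ζ (D (Hop n M M₀ z (Gop n M a (Hop n M M₀ z (vsrc n M J)))))
  have h2 := hD z (Hop n M M₀ z (vsrc n M J))
  have h3 := norm_Hop_vsrc_le (a := a) (k := k) z J
  have hζ := cutSupL_nonneg (n := n) (M := M) ζ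
  have hJ : 0 ≤ (latticeSettingP12R n M a k).l2Norm J := (norm_nonneg _).trans h3
  calc _ ≤ cutSupL n M ζ * ‖D (Hop n M M₀ z (Gop n M a (Hop n M M₀ z (vsrc n M J))))‖ := h1
    _ ≤ cutSupL n M ζ * (K * (latticeSettingP12R n M a k).l2Norm J) :=
        mul_le_mul_of_nonneg_left (h2.trans (mul_le_mul_of_nonneg_left h3 hK)) hζ
    _ ≤ cutSupL n M ζ * (c1 d γ₀ * (latticeSettingP12R n M a k).l2Norm J) :=
        mul_le_mul_of_nonneg_left (mul_le_mul_of_nonneg_right hKc hJ) hζ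
    _ = _ := by ring

/-- **RIGHT CERTIFICATE, entry `m = 0` (`‖ζGJ‖`: `D₁ = D₂ = 1`).** [cite: Balaban1984PropagatorsI, (1.125), (1.129), (1.130) p.38, p.39] -/
theorem rightCert_zero : RightCert (latticeSettingP12R n M a k) (Gop n M a) (Dg n M) (Hop n M M₀) (ctr M M₀) (sitePt M) (vsrc n M)
    (cut n M) (D1v n M 0) (D2v n M 0) (cbar * M₀) (cF d γ₀) (cL d γ₀) (c1 d γ₀) := by
  have hγ' := (inv_pos.mpr hγ).le
  have hF := inv_le_cF (d := d) hγ
  unfold RightCert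
  rw [D1v_zero, D2v_zero]
  refine ⟨fun z B => ?_, fun B => ?_, fun ζ y hζ z hfar => ?_, fun J z => ?_, fun ζ J z => ?_⟩
  · rw [Module.End.one_apply]
    exact ((norm_Hop_le z _).trans (norm_Gop_le hn hγ hcl B)).trans (mul_le_mul_of_nonneg_right hF (norm_nonneg _))
  · rw [Module.End.one_apply]
    exact (norm_Gop_le hn hγ hcl B).trans (mul_le_mul_of_nonneg_right hF (norm_nonneg _))
  · rw [← D1v_zero]; exact cut_D1v_Hop_eq_zero a k hn hM₀ hc 0 ζ y hζ z hfar
  · rw [Module.End.one_apply]; exact member4_one hn hγ hcl J z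
  · rw [Module.End.one_apply]
    exact member5_one (D := 1) hγ' ((inv_le_cF hγ).trans (cF_le_c1 hγ))
      (fun z B => by rw [Module.End.one_apply]; exact (norm_Hop_le z _).trans (norm_Gop_le hn hγ hcl B)) ζ J z

/-- **RIGHT CERTIFICATE, entry `m = 1` (`‖ζ∇GJ‖`: `D₁ = ∇`, `D₂ = 1`).** [cite: Balaban1984PropagatorsI, (1.125), (1.129), (1.130) p.38, p.39] -/
theorem rightCert_one : RightCert (latticeSettingP12R n M a k) (Gop n M a) (Dg n M) (Hop n M M₀) (ctr M M₀) (sitePt M) (vsrc n M)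
    (cut n M) (D1v n M 1) (D2v n M 1) (cbar * M₀) (cF d γ₀) (cL d γ₀) (c1 d γ₀) := by
  have hγ' := (inv_pos.mpr hγ).le
  unfold RightCert
  rw [D1v_one, D2v_one]
  refine ⟨fun z B => ?_, fun B => ?_, fun ζ y hζ z hfar => ?_, fun J z => ?_, fun ζ J z => ?_⟩
  · exact (norm_gradOp_Hop_Gop_le hn hM₀ hγ hcl z B).trans (mul_le_mul_of_nonneg_right (KF1_le_cF hM₀ hγ) (norm_nonneg _))
  · exact (norm_gradOp_Gop_le hn hγ hcl B).trans (mul_le_mul_of_nonneg_right (inv_le_cF hγ) (norm_nonneg _))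
  · rw [← D1v_one]; exact cut_D1v_Hop_eq_zero a k hn hM₀ hc 1 ζ y hζ z hfar
  · rw [Module.End.one_apply]; exact member4_one hn hγ hcl J z
  · rw [Module.End.one_apply]
    exact member5_one (KF1_nonneg hγ) ((KF1_le_cF hM₀ hγ).trans (cF_le_c1 hγ))
      (fun z B => norm_gradOp_Hop_Gop_le hn hM₀ hγ hcl z B) ζ J z

/-- **RIGHT CERTIFICATE, entry `m = 4` (`‖ζ∇∇GJ‖`: `D₁ = ∇∇`, `D₂ = 1`).** [cite: Balaban1984PropagatorsI, (1.125), (1.129), (1.130) p.38, p.39] -/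
theorem rightCert_four : RightCert (latticeSettingP12R n M a k) (Gop n M a) (Dg n M) (Hop n M M₀) (ctr M M₀) (sitePt M) (vsrc n M)
    (cut n M) (D1v n M 4) (D2v n M 4) (cbar * M₀) (cF d γ₀) (cL d γ₀) (c1 d γ₀) := by
  have hγ' := (inv_pos.mpr hγ).le
  unfold RightCert
  rw [D1v_four, D2v_four]
  refine ⟨fun z B => ?_, fun B => ?_, fun ζ y hζ z hfar => ?_, fun J z => ?_, fun ζ J z => ?_⟩
  · rw [Module.End.mul_apply]
    exact (norm_gradOp_gradOp_Hop_Gop_le hn hM₀ hγ hcl z B).trans (mul_le_mul_of_nonneg_right (KF2_le_cF hM₀ hγ) (norm_nonneg _))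
  · rw [Module.End.mul_apply]
    exact (norm_gradOp_gradOp_Gop_le hn hγ hcl B).trans (mul_le_mul_of_nonneg_right (inv_le_cF hγ) (norm_nonneg _))
  · rw [← D1v_four]; exact cut_D1v_Hop_eq_zero a k hn hM₀ hc 4 ζ y hζ z hfar
  · rw [Module.End.one_apply]; exact member4_one hn hγ hcl J z
  · rw [Module.End.one_apply]
    exact member5_one (KF2_nonneg hγ) ((KF2_le_cF hM₀ hγ).trans (cF_le_c1 hγ))
      (fun z B => by rw [Module.End.mul_apply]; exact norm_gradOp_gradOp_Hop_Gop_le hn hM₀ hγ hcl z B) ζ J z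

/-- **RIGHT CERTIFICATE, entry `m = 3` (`‖ζ∇G∇*J‖`: `D₁ = ∇`, `D₂ = ∇*`, the one-factor term (1.130)).**
[cite: Balaban1984PropagatorsI, (1.125), (1.129), (1.130) p.38, p.39] -/
theorem rightCert_three : RightCert (latticeSettingP12R n M a k) (Gop n M a) (Dg n M) (Hop n M M₀) (ctr M M₀) (sitePt M) (vsrc n M)
    (cut n M) (D1v n M 3) (D2v n M 3) (cbar * M₀) (cF d γ₀) (cL d γ₀) (c1 d γ₀) := by
  have hγ' := (inv_pos.mpr hγ).le
  unfold RightCert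
  rw [D1v_three, D2v_three]
  refine ⟨fun z B => ?_, fun B => ?_, fun ζ y hζ z hfar => ?_, fun J z => ?_, fun ζ J z => ?_⟩
  · exact (norm_gradOp_Hop_Gop_le hn hM₀ hγ hcl z B).trans (mul_le_mul_of_nonneg_right (KF1_le_cF hM₀ hγ) (norm_nonneg _))
  · exact (norm_gradOp_Gop_le hn hγ hcl B).trans (mul_le_mul_of_nonneg_right (inv_le_cF hγ) (norm_nonneg _))
  · rw [← D1v_three]; exact cut_D1v_Hop_eq_zero a k hn hM₀ hc 3 ζ y hζ z hfar
  · have h1 := norm_Dg_Gop_Hop_divOp_le hn hM₀ hγ hcl z (vsrc n M J)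
    have h2 := norm_Gop_Hop_divOp_le hn hM₀ hγ hcl z (vsrc n M J)
    rw [norm_vsrc a k J] at h1 h2
    have h4 := two_KD_le_cL (d := d) hM₀ hγ
    have hJ : 0 ≤ (latticeSettingP12R n M a k).l2Norm J := by rw [← norm_vsrc a k J]; exact norm_nonneg _
    calc _ ≤ KD d γ₀ M₀ * (latticeSettingP12R n M a k).l2Norm J + KD d γ₀ M₀ * (latticeSettingP12R n M a k).l2Norm J :=
          add_le_add h1 h2
      _ = (2 * KD d γ₀ M₀) * (latticeSettingP12R n M a k).l2Norm J := by ring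
      _ ≤ _ := mul_le_mul_of_nonneg_right h4 hJ
  · have h1 := norm_cut_le ζ (gradOp n M (Hop n M M₀ z (Gop n M a (Hop n M M₀ z (divOp n M (vsrc n M J))))))
    have h2 := norm_gradOp_Hop_Gop_Hop_divOp_le hn hM₀ hγ hcl z (vsrc n M J)
    rw [norm_vsrc a k J] at h2
    have hζ := cutSupL_nonneg (n := n) (M := M) ζ
    have hJ : 0 ≤ (latticeSettingP12R n M a k).l2Norm J := by rw [← norm_vsrc a k J]; exact norm_nonneg _
    have h3 := KD1_le_c1 (d := d) hM₀ hγ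
    calc _ ≤ cutSupL n M ζ * ‖gradOp n M (Hop n M M₀ z (Gop n M a (Hop n M M₀ z (divOp n M (vsrc n M J)))))‖ := h1
      _ ≤ cutSupL n M ζ * (KD1 d γ₀ M₀ * (latticeSettingP12R n M a k).l2Norm J) := mul_le_mul_of_nonneg_left h2 hζ
      _ ≤ cutSupL n M ζ * (c1 d γ₀ * (latticeSettingP12R n M a k).l2Norm J) :=
          mul_le_mul_of_nonneg_left (mul_le_mul_of_nonneg_right h3 hJ) hζ
      _ = c1 d γ₀ * cutSupL n M ζ * (latticeSettingP12R n M a k).l2Norm J := by ring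

/-- **LEFT CERTIFICATE, entry `m = 2` (`‖ζG∇*J‖`: `D₁ = 1`, `D₂† = ∇`).** [cite: Balaban1984PropagatorsI, p.39 (adjoint representation), (1.125) p.38] -/
theorem leftCert_two : LeftCert (latticeSettingP12R n M a k) (Gop n M a) (Hop n M M₀) (ctr M M₀) (sitePt M) (cut n M)
    (D1v n M 2) (Dadjv n M 2) (D2v n M 2) (cbar * M₀) (cF d γ₀) := by
  unfold LeftCert
  rw [Dadjv_two]
  refine ⟨rfl, fun z B => ?_, fun B => ?_, fun u v => ?_, fun ζ y hζ z hfar => ?_⟩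
  · exact (norm_gradOp_Hop_Gop_le hn hM₀ hγ hcl z B).trans (mul_le_mul_of_nonneg_right (KF1_le_cF hM₀ hγ) (norm_nonneg _))
  · exact (norm_gradOp_Gop_le hn hγ hcl B).trans (mul_le_mul_of_nonneg_right (inv_le_cF hγ) (norm_nonneg _))
  · rw [← Dadjv_two]; exact Dadjv_adjoint 2 u v
  · exact Hop_cut_eq_zero a k hn hM₀ hc ζ y hζ z hfar

/-- **LEFT CERTIFICATE, entry `m = 5` (`‖ζG∇*∇*J‖`: `D₁ = 1`, `D₂† = ∇∇`).** [cite: Balaban1984PropagatorsI, p.39 (adjoint representation), (1.125) p.38] -/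
theorem leftCert_five : LeftCert (latticeSettingP12R n M a k) (Gop n M a) (Hop n M M₀) (ctr M M₀) (sitePt M) (cut n M)
    (D1v n M 5) (Dadjv n M 5) (D2v n M 5) (cbar * M₀) (cF d γ₀) := by
  unfold LeftCert
  rw [Dadjv_five]
  refine ⟨rfl, fun z B => ?_, fun B => ?_, fun u v => ?_, fun ζ y hζ z hfar => ?_⟩
  · rw [Module.End.mul_apply]
    exact (norm_gradOp_gradOp_Hop_Gop_le hn hM₀ hγ hcl z B).trans (mul_le_mul_of_nonneg_right (KF2_le_cF hM₀ hγ) (norm_nonneg _))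
  · rw [Module.End.mul_apply]
    exact (norm_gradOp_gradOp_Gop_le hn hγ hcl B).trans (mul_le_mul_of_nonneg_right (inv_le_cF hγ) (norm_nonneg _))
  · rw [← Dadjv_five]; exact Dadjv_adjoint 5 u v
  · exact Hop_cut_eq_zero a k hn hM₀ hc ζ y hζ z hfar

/-- **THE FIELD `hcert` OF `B5Local114.Realisation` FOR THE TORUS OF RECORD**: for every `γ₀ > 0` satisfying the abstract Prop-1.1
clause, every entry `m` of (1.114) carries a right certificate (m = 0, 1, 3, 4) or a left certificate (m = 2, 5) with the uniform
constants `c_F(γ₀), c_L(γ₀), c₁(γ₀)` and radius `c̄M₀`. [cite: Balaban1984PropagatorsI, (1.125), (1.129), (1.130) p.38, p.39] -/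
theorem hcert_holds (m : Fin 6) :
    RightCert (latticeSettingP12R n M a k) (Gop n M a) (Dg n M) (Hop n M M₀) (ctr M M₀) (sitePt M) (vsrc n M) (cut n M)
        (D1v n M m) (D2v n M m) (cbar * M₀) (cF d γ₀) (cL d γ₀) (c1 d γ₀) ∨
      LeftCert (latticeSettingP12R n M a k) (Gop n M a) (Hop n M M₀) (ctr M M₀) (sitePt M) (cut n M)
        (D1v n M m) (Dadjv n M m) (D2v n M m) (cbar * M₀) (cF d γ₀) := by
  rcases m with ⟨_ | _ | _ | _ | _ | _ | j, hj⟩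
  · exact Or.inl (rightCert_zero hn hM₀ hγ hcl hc)
  · exact Or.inl (rightCert_one hn hM₀ hγ hcl hc)
  · exact Or.inr (leftCert_two hn hM₀ hγ hcl hc)
  · exact Or.inl (rightCert_three hn hM₀ hγ hcl hc)
  · exact Or.inl (rightCert_four hn hM₀ hγ hcl hc)
  · exact Or.inr (leftCert_five hn hM₀ hγ hcl hc)
  · exact absurd hj (by omega)

end Certs

end

end Literature.MathematicalPhysics.QuantumFieldTheory.Balaban1983to89.B5WalkCertsTorus
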